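import Summits.QuantumFields.BalabanUV.T4Continuum.Spine.NE1p.TiltedMeanInfluence

/-!
# T⁴ programme, spine estimate NE1′ (node O3b/H2) — WHERE THE SECOND SMALL FACTOR OF A VISIBILITY COMES FROM: a slot that
# DISPLACES the unit field with a CENTRED displacement law is seen at SECOND order against a background law with bounded second
# differences (discrete periodic toy; uncentred ⇒ first order × the background's first differences)

Cell `pub-balaban-gaps` (YM blitz Y1, track G2), seat `ne1` gen 5 (prover-pub-balaban-gaps-ne1-g5-0), record `HOME/ne/NE1.md`
§4 row R39 (gen 5).  SIBLING of `Spine/NE1p/TiltedMeanVisibility` (same generation; INTENT [GAPSNE1-G5-INTENT-1]): imports the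
seat's gen-4 `TiltedMeanInfluence` (p345768 ✓) ONLY, for Mathlib and the namespace lineage — nothing of it is used in the proofs,
which are finite sums on `ZMod M`; modifies nothing; 3 plain data defs (`bdiff` a backward difference `Dp u = p u − p(u−1)`, `l1Norm`
the finite norm `‖p‖₁ = Σ_u |p u|`, `displace` a finite mixture of translates) + 16 theorems.

WHAT THIS IS.  `TiltedMeanVisibility` (gen 5, file 1) showed that the per-slot producer input of the old-component influence budget
is an UNTILTED, OBSERVABLE-FREE L¹-visibility of the slot's weight from the unit lattice — the `‖·‖₁`-distance of the unit-field
class laws before and after the slot is switched on — and said honestly that visibility is FIRST order in «how far the slot is seen»,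
the second small factor being the producer's power counting.  This file isolates, in the smallest model that has it, the MECHANISM
of that second factor — the visibility-currency counterpart of gen 4's `abs_influence_le_of_centred` (`≤ 2a²|s|`, product law, tilt):
* MODEL.  Unit field `u ∈ ZMod M` (periodic, one coordinate); background law `p : ZMod M → ℝ` (the class law of the unit field
  with the slot switched OFF — all other slots integrated: they are the mollifier); switching the slot on DISPLACES `u` by `y`
  with weight `κ y`, `y < R` (`displace p κ R u = Σ_{y<R} κ y·p(u − y)`): `y` = the slot's fluctuation read through `K − j` block
  averagings (transfer LINEARISED, coefficient `θ₁^{K−j}` in units where `p` has width 1 — the loop∕unit field is UV-irrelevant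
  w.r.t. the slot; Bałaban's averaging itself is nonlinear), `κ` = its law.  Two treatments `κ_A`, `κ_B` of the slot (reference ∕ re-sampled).
* `l1_displace_sub_le_zeroth`: `‖p_B − p_A‖₁ ≤ (Σ|κ_B − κ_A|)·‖p‖₁` — no cancellation (gen 4's `≤ 2a`).
* `l1_displace_sub_le_first`: equal masses ⇒ `‖p_B − p_A‖₁ ≤ (Σ_y |κ_B y − κ_A y|·y)·‖Dp‖₁` — FIRST order in the displacement
  against the background's FIRST differences `Dp u = p u − p(u − 1)`; driven by the MEAN SHIFT of the displacement (the conditional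
  mean `m_j(U) ≠ 0` off the flat orbit of NE1.md R34 — the channel R28 (2) books with the flatness factor).
* `l1_displace_sub_le_second`: equal masses AND equal means (CENTRED displacement — conjugation symmetry at a flat exterior, kernel
  `T4AdInvariant`) ⇒ `‖p_B − p_A‖₁ ≤ (Σ_y |κ_B y − κ_A y|·Σ_{k<y} k)·‖D(Dp)‖₁`, `Σ_{k<y} k = y(y−1)∕2` — SECOND order in the
  displacement against the background's SECOND differences (discrete Taylor with remainder, `shift_eq_taylor2`; the orders 0 and 1
  cancel by the two hypotheses).
* `l1_displace_sub_eq_half`: the second-order bound is ATTAINED (`κ_A = δ₁`, `κ_B = ½δ₀ + ½δ₂`: `p_B − p_A = ½·D(Dp)` exactly).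
* A COMPUTED VISIBILITY LEDGER (`sum_visibility_chain_le`): along a chain of backgrounds `P (i+1) = displace (P i) (κ i) (R i)` —
  slot `i` ON = displacement law `κ i` (mass 1, integer mean `c i`), OFF = frozen at the mean (`δ_{c i}`, `displace_dirac`) —
  smoothness is INHERITED (`l1Norm_bdiff2_displace_le`: `‖D²(displace p κ)‖₁ ≤ ‖D²p‖₁`, the other slots mollify, never sharpen),
  so every slot's visibility is second order against the INITIAL background: `Σ_{i<n} ‖P(i+1) − P i(· − c i)‖₁ ≤ (Σ_i C i)·‖D²(P 0)‖₁`,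
  `C i = Σ_y |κ i y − δ_{c i} y|·Σ_{k<y} k` — the `hvis` ledger of file 1's `oldInfluenceBudget_of_visibility` INHABITED BY COMPUTATION
  in a model whose slots interact through an arbitrary observable (which never enters).
READING (not certified, not asserted): with `p` of width `σ` lattice units, `‖Dp‖₁ ≍ σ⁻¹`, `‖D(Dp)‖₁ ≍ σ⁻²`, displacement `O(1)`:
relative displacement `ε = σ⁻¹ = θ₁^{K−j}`; visibility `≍ ε` (uncentred: ratio `θ₁Λ = L` per level before the flatness factor) vs
`≍ ε²` (centred: ratio `θ₁²Λ = L⁻²`), NE1.md R2 ∕ R28 ∕ R33.  So in visibility currency the two inputs behind «second order» are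
{centring of the slot's LINEAR image under both treatments [symmetry, kernel elsewhere], bounded second differences of the unit-field
class law [the small-field analyticity ∕ smoothness of Bałaban's densities — [B14] §2, [B16] §1 KIND]} — and NO property of the
observable at all (file 1: it enters through `B` only), NO additivity of the loop in the slots, NO tilt.

HONEST FRAMING.  A finite-sum toy on `ZMod M` ([folklore]: discrete Taylor expansion, translation invariance of `‖·‖₁`); NOTHING
of Bałaban's is asserted or instantiated; no lattice gauge measure occurs; the identification «slot = displacement of the unit field
by a centred law, background = smooth» is this seat's READING of the structure (block averaging [B7 (10)] LINEARISED, transfer rate θ₁ = L^{1−d} as in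
`T4AvgDerivBound` ∕ `T4LoopPullback.theta1_exact`; conjugation symmetry; small-field densities), recorded in NE1.md R39 as such.  NE1′ NOT proved; spine 0∕9; (B) 0∕13; one fixed finite T⁴ — NOT
ℝ⁴, NOT infinite volume, NOT a mass gap, NOT Clay.  0 sorry.
-/

noncomputable section

open Finset
open scoped BigOperators

namespace Summit.QuantumFields.BalabanUV.T4Continuum.NE1p.TiltedMeanVisibilityCentred

variable {M : ℕ}

/-- Backward difference of a function on the periodic unit lattice `ZMod M`: `bdiff p u = p u − p (u − 1)`. [folklore] -/
def bdiff (p : ZMod M → ℝ) : ZMod M → ℝ := fun u => p u - p (u - 1)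

/-- DISCRETE TAYLOR, FIRST ORDER: `p (u − y) = p u − Σ_{k<y} bdiff p (u − k)`. [folklore] -/
theorem shift_eq_sub_sum_bdiff (p : ZMod M → ℝ) (u : ZMod M) (y : ℕ) :
    p (u - y) = p u - ∑ k ∈ range y, bdiff p (u - k) := by
  induction y with
  | zero => simp
  | succ y ih =>
    rw [sum_range_succ, ← sub_sub, ← ih]
    simp only [bdiff, Nat.cast_succ]
    ring_nf

/-- DISCRETE TAYLOR, SECOND ORDER: `p (u − y) = p u − y·bdiff p u + Σ_{k<y} Σ_{l<k} bdiff (bdiff p) (u − l)`. [folklore] -/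
theorem shift_eq_taylor2 (p : ZMod M → ℝ) (u : ZMod M) (y : ℕ) :
    p (u - y) = p u - y * bdiff p u + ∑ k ∈ range y, ∑ l ∈ range k, bdiff (bdiff p) (u - l) := by
  rw [shift_eq_sub_sum_bdiff p u y]
  have h : ∀ k ∈ range y, bdiff p (u - k) = bdiff p u - ∑ l ∈ range k, bdiff (bdiff p) (u - l) :=
    fun k _ => shift_eq_sub_sum_bdiff (bdiff p) u k
  rw [sum_congr rfl h, sum_sub_distrib, sum_const, card_range, nsmul_eq_mul]
  ring

section Periodic

variable [NeZero M]

/-- The discrete L¹ norm on the periodic unit lattice, `‖p‖₁ = Σ_u |p u|`. [folklore] -/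
def l1Norm (p : ZMod M → ℝ) : ℝ := ∑ u, |p u|

/-- `‖·‖₁` is translation invariant: `Σ_u |p (u − l)| = ‖p‖₁`. [folklore] -/
theorem l1_shift (p : ZMod M → ℝ) (l : ZMod M) : ∑ u, |p (u - l)| = l1Norm p :=
  Fintype.sum_equiv (Equiv.subRight l) _ _ fun _ => rfl

/-- THE UNIT-FIELD LAW WITH THE SLOT SWITCHED ON: background law `p` on `ZMod M`, the slot displaces the unit field by `y` with
weight `κ y`, `y < R` (in the application: `y` = the slot's fluctuation read through `K − j` block averagings, in units of the
resolution of `ZMod M`; `κ` = its law under the class law): `displace p κ R u = Σ_{y<R} κ y · p (u − y)`. [folklore] -/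
def displace (p : ZMod M → ℝ) (κ : ℕ → ℝ) (R : ℕ) : ZMod M → ℝ := fun u => ∑ y ∈ range R, κ y * p (u - ↑y)

/-- Inner bookkeeping: `Σ_u Σ_{k<y} Σ_{l<k} |q (u − l)| = (Σ_{k<y} k)·‖q‖₁` (translation invariance; `Σ_{k<y} k = y(y−1)∕2`).
[folklore] -/
theorem sum_sum_sum_shift_eq (q : ZMod M → ℝ) (y : ℕ) :
    ∑ u, ∑ k ∈ range y, ∑ l ∈ range k, |q (u - ↑l)| = (∑ k ∈ range y, (k : ℝ)) * l1Norm q := by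
  rw [sum_comm, sum_mul]
  refine sum_congr rfl fun k _ => ?_
  rw [sum_comm]
  simp_rw [l1_shift]
  rw [sum_const, card_range, nsmul_eq_mul]

/-- Inner bookkeeping, first order: `Σ_u Σ_{k<y} |q (u − k)| = y·‖q‖₁`. [folklore] -/
theorem sum_sum_shift_eq (q : ZMod M → ℝ) (y : ℕ) : ∑ u, ∑ k ∈ range y, |q (u - ↑k)| = (y : ℝ) * l1Norm q := by
  rw [sum_comm]
  simp_rw [l1_shift]
  rw [sum_const, card_range, nsmul_eq_mul]

/-- ZEROTH ORDER (no cancellation used): switching between two displacement laws moves the unit-field law in `‖·‖₁` by at most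
`(Σ_y |κ_B y − κ_A y|)·‖p‖₁` — the trivial first-order-in-nothing bound (cf. gen 4's `abs_influence_le`: `≤ 2a`). [folklore] -/
theorem l1_displace_sub_le_zeroth (p : ZMod M → ℝ) (κA κB : ℕ → ℝ) (R : ℕ) :
    l1Norm (fun u => displace p κB R u - displace p κA R u) ≤ (∑ y ∈ range R, |κB y - κA y|) * l1Norm p := by
  unfold l1Norm
  have hpt : ∀ u, displace p κB R u - displace p κA R u = ∑ y ∈ range R, (κB y - κA y) * p (u - ↑y) := by
    intro u; simp only [displace, ← sum_sub_distrib]; exact sum_congr rfl fun y _ => by ring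
  calc ∑ u, |displace p κB R u - displace p κA R u|
      ≤ ∑ u, ∑ y ∈ range R, |κB y - κA y| * |p (u - ↑y)| :=
        sum_le_sum fun u _ => by rw [hpt u]; exact (abs_sum_le_sum_abs _ _).trans (le_of_eq (sum_congr rfl fun y _ => abs_mul _ _))
    _ = ∑ y ∈ range R, |κB y - κA y| * ∑ u, |p (u - ↑y)| := by rw [sum_comm]; exact sum_congr rfl fun y _ => (mul_sum _ _ _).symm
    _ = (∑ y ∈ range R, |κB y - κA y|) * ∑ u, |p u| := by
        rw [sum_mul]; exact sum_congr rfl fun y _ => by rw [l1_shift]; rfl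

/-- **FIRST ORDER: EQUAL MASSES.**  If the two displacement laws have the same mass (`Σ_y (κ_B y − κ_A y) = 0`) then
`‖displace p κ_B − displace p κ_A‖₁ ≤ (Σ_y |κ_B y − κ_A y|·y)·‖bdiff p‖₁` — first order in the displacement against the background's
FIRST differences; the coefficient is driven by the displacement's MEAN SHIFT (a conditional mean `m_j(U) ≠ 0` off the flat orbit,
NE1.md R34 ∕ R28 (2)).  Discrete Taylor to first order. [folklore] -/
theorem l1_displace_sub_le_first (p : ZMod M → ℝ) (κA κB : ℕ → ℝ) (R : ℕ) (h0 : ∑ y ∈ range R, (κB y - κA y) = 0) :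
    l1Norm (fun u => displace p κB R u - displace p κA R u) ≤ (∑ y ∈ range R, |κB y - κA y| * y) * l1Norm (bdiff p) := by
  unfold l1Norm
  have hpt : ∀ u, displace p κB R u - displace p κA R u = -∑ y ∈ range R, (κB y - κA y) * ∑ k ∈ range y, bdiff p (u - ↑k) := by
    intro u
    have h : ∀ y ∈ range R, κB y * p (u - ↑y) - κA y * p (u - ↑y)
        = (κB y - κA y) * p u - (κB y - κA y) * ∑ k ∈ range y, bdiff p (u - ↑k) := by
      intro y _; rw [shift_eq_sub_sum_bdiff p u y]; ring
    simp only [displace]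
    rw [← sum_sub_distrib, sum_congr rfl h, sum_sub_distrib, ← sum_mul, h0, zero_mul, zero_sub]
  calc ∑ u, |displace p κB R u - displace p κA R u|
      ≤ ∑ u, ∑ y ∈ range R, |κB y - κA y| * ∑ k ∈ range y, |bdiff p (u - ↑k)| :=
        sum_le_sum fun u _ => by
          rw [hpt u, abs_neg]
          exact (abs_sum_le_sum_abs _ _).trans (sum_le_sum fun y _ => by
            rw [abs_mul]; exact mul_le_mul_of_nonneg_left (abs_sum_le_sum_abs _ _) (abs_nonneg _))
    _ = ∑ y ∈ range R, |κB y - κA y| * ∑ u, ∑ k ∈ range y, |bdiff p (u - ↑k)| := by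
        rw [sum_comm]; exact sum_congr rfl fun y _ => (mul_sum _ _ _).symm
    _ = (∑ y ∈ range R, |κB y - κA y| * y) * ∑ u, |bdiff p u| := by
        rw [sum_mul]; exact sum_congr rfl fun y _ => by rw [sum_sum_shift_eq]; unfold l1Norm; ring

/-- **SECOND ORDER: EQUAL MASSES AND EQUAL MEANS (CENTRED DISPLACEMENT).**  If the two displacement laws have the same mass AND the
same mean (`Σ_y y·(κ_B y − κ_A y) = 0` — in the application: the slot's linear image in the unit field is centred under both laws,
conjugation symmetry at a flat exterior, kernel `T4AdInvariant`), then
`‖displace p κ_B − displace p κ_A‖₁ ≤ (Σ_y |κ_B y − κ_A y|·Σ_{k<y} k)·‖bdiff (bdiff p)‖₁` — SECOND order in the displacement (`Σ_{k<y} k =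
y(y−1)∕2`) against the background's SECOND differences.  Discrete Taylor to second order (`shift_eq_taylor2`): the zeroth- and
first-order terms cancel by the two hypotheses.  This is the visibility-currency form of gen 4's `abs_influence_le_of_centred`
(`≤ 2a²|s|`): there the second factor came from the tilt acting on an additive slot term; here, with NO additivity and NO tilt, it
comes from the smoothness of the BACKGROUND law (the other slots act as a mollifier) — which is where Bałaban's small-field
analyticity lives.  The displacement size in units where `p` has width `1` is the loop's transfer coefficient `θ₁^{K−j}` (reading,
not certified). [folklore] -/
theorem l1_displace_sub_le_second (p : ZMod M → ℝ) (κA κB : ℕ → ℝ) (R : ℕ) (h0 : ∑ y ∈ range R, (κB y - κA y) = 0)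
    (h1 : ∑ y ∈ range R, (y : ℝ) * (κB y - κA y) = 0) :
    l1Norm (fun u => displace p κB R u - displace p κA R u)
      ≤ (∑ y ∈ range R, |κB y - κA y| * ∑ k ∈ range y, (k : ℝ)) * l1Norm (bdiff (bdiff p)) := by
  unfold l1Norm
  have hpt : ∀ u, displace p κB R u - displace p κA R u
      = ∑ y ∈ range R, (κB y - κA y) * ∑ k ∈ range y, ∑ l ∈ range k, bdiff (bdiff p) (u - ↑l) := by
    intro u
    have h : ∀ y ∈ range R, κB y * p (u - ↑y) - κA y * p (u - ↑y)
        = (κB y - κA y) * p u - (y : ℝ) * (κB y - κA y) * bdiff p u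
          + (κB y - κA y) * ∑ k ∈ range y, ∑ l ∈ range k, bdiff (bdiff p) (u - ↑l) := by
      intro y _; rw [shift_eq_taylor2 p u y]; ring
    simp only [displace]
    rw [← sum_sub_distrib, sum_congr rfl h, sum_add_distrib, sum_sub_distrib, ← sum_mul, ← sum_mul, h0, h1]
    ring
  calc ∑ u, |displace p κB R u - displace p κA R u|
      ≤ ∑ u, ∑ y ∈ range R, |κB y - κA y| * ∑ k ∈ range y, ∑ l ∈ range k, |bdiff (bdiff p) (u - ↑l)| :=
        sum_le_sum fun u _ => by
          rw [hpt u]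
          exact (abs_sum_le_sum_abs _ _).trans (sum_le_sum fun y _ => by
            rw [abs_mul]
            exact mul_le_mul_of_nonneg_left
              ((abs_sum_le_sum_abs _ _).trans (sum_le_sum fun k _ => abs_sum_le_sum_abs _ _)) (abs_nonneg _))
    _ = ∑ y ∈ range R, |κB y - κA y| * ∑ u, ∑ k ∈ range y, ∑ l ∈ range k, |bdiff (bdiff p) (u - ↑l)| := by
        rw [sum_comm]; exact sum_congr rfl fun y _ => (mul_sum _ _ _).symm
    _ = (∑ y ∈ range R, |κB y - κA y| * ∑ k ∈ range y, (k : ℝ)) * ∑ u, |bdiff (bdiff p) u| := by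
        rw [sum_mul]; exact sum_congr rfl fun y _ => by rw [sum_sum_sum_shift_eq]; unfold l1Norm; ring

/-- **THE SECOND-ORDER BOUND IS ATTAINED.**  Reference slot `κ_A = δ₁` (displacement `1` surely) against `κ_B = ½δ₀ + ½δ₂` (same
mass, same mean, larger variance): the difference of the two unit-field laws is EXACTLY `½·bdiff (bdiff p)`, so its `‖·‖₁` is
`½‖bdiff (bdiff p)‖₁` — equal to the bound of `l1_displace_sub_le_second` (`Σ_y |κ_B y − κ_A y|·Σ_{k<y} k = ½·0 + 1·0 + ½·1`).  Non-vacuity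
and tightness of the toy at once. [folklore] -/
theorem l1_displace_sub_eq_half (p : ZMod M → ℝ) :
    l1Norm (fun u => displace p (fun y => if y = 0 then 1 / 2 else if y = 2 then 1 / 2 else 0) 3 u
        - displace p (fun y => if y = 1 then 1 else 0) 3 u) = 1 / 2 * l1Norm (bdiff (bdiff p)) := by
  unfold l1Norm
  rw [mul_sum]
  refine sum_congr rfl fun u _ => ?_
  simp only [displace, bdiff, sum_range_succ, sum_range_zero]
  norm_num
  rw [show p (u - 1 - 1) = p (u - 2) by ring_nf, ← abs_of_pos (by norm_num : (0 : ℝ) < 1 / 2), ← abs_mul]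
  congr 1
  ring

/-! ### A chain of slots: switching on centred displacements one at a time — a COMPUTED visibility ledger -/

omit [NeZero M] in
/-- `bdiff` commutes with `displace` (both are linear and translation-covariant). [folklore] -/
theorem bdiff_displace (p : ZMod M → ℝ) (κ : ℕ → ℝ) (R : ℕ) :
    bdiff (displace p κ R) = displace (bdiff p) κ R := by
  funext u
  simp only [bdiff, displace, ← sum_sub_distrib]
  refine sum_congr rfl fun y _ => ?_
  rw [show u - 1 - (y : ZMod M) = u - y - 1 by ring]
  ring

omit [NeZero M] in
/-- `displace` against the zero law is zero. [folklore] -/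
theorem displace_zero_law (p : ZMod M → ℝ) (R : ℕ) : displace p (fun _ => 0) R = 0 := by
  funext u; simp [displace]

/-- `‖displace q κ‖₁ ≤ (Σ_y |κ y|)·‖q‖₁` (Young ∕ triangle inequality; `l1_displace_sub_le_zeroth` against the zero law). [folklore] -/
theorem l1Norm_displace_le (q : ZMod M → ℝ) (κ : ℕ → ℝ) (R : ℕ) :
    l1Norm (displace q κ R) ≤ (∑ y ∈ range R, |κ y|) * l1Norm q := by
  have h := l1_displace_sub_le_zeroth q (fun _ => 0) κ R
  simp only [displace_zero_law, Pi.zero_apply, sub_zero] at h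
  exact h

/-- **SMOOTHNESS IS INHERITED ALONG THE CHAIN**: switching on a slot with a displacement LAW (`κ ≥ 0`, mass `1`) does not increase the
background's second differences: `‖D²(displace p κ)‖₁ ≤ ‖D²p‖₁` — the other slots act as a mollifier, never as a sharpener. [folklore] -/
theorem l1Norm_bdiff2_displace_le (p : ZMod M → ℝ) {κ : ℕ → ℝ} {R : ℕ} (hκ : ∀ y, 0 ≤ κ y) (hmass : ∑ y ∈ range R, κ y = 1) :
    l1Norm (bdiff (bdiff (displace p κ R))) ≤ l1Norm (bdiff (bdiff p)) := by
  rw [bdiff_displace, bdiff_displace]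
  have h := l1Norm_displace_le (bdiff (bdiff p)) κ R
  rwa [show ∑ y ∈ range R, |κ y| = 1 by rw [← hmass]; exact sum_congr rfl fun y _ => abs_of_nonneg (hκ y), one_mul] at h

omit [NeZero M] in
/-- The displacement law `δ_c` (the slot OFF: a sure displacement by the reference index `c < R`) reproduces the background shifted by
`c`; in particular switching from `δ_c` to a law `κ` of mass `1` and mean `c` is the CENTRED comparison of `l1_displace_sub_le_second`.
[folklore] -/
theorem displace_dirac (p : ZMod M → ℝ) {c R : ℕ} (hc : c < R) :
    displace p (fun y => if y = c then 1 else 0) R = fun u => p (u - c) := by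
  funext u
  simp only [displace, ite_mul, one_mul, zero_mul]
  rw [sum_ite_eq' (range R) c (fun y => p (u - (y : ZMod M)))]
  simp [mem_range.mpr hc]

/-- Mass and first moment of the frozen law `δ_c` on `range R` (`c < R`). [folklore] -/
theorem sum_dirac_eq {c R : ℕ} (hc : c < R) (f : ℕ → ℝ) :
    ∑ y ∈ range R, f y * (if y = c then (1 : ℝ) else 0) = f c := by
  simp only [mul_ite, mul_one, mul_zero]
  rw [sum_ite_eq' (range R) c f]
  simp [mem_range.mpr hc]

/-- **A COMPUTED VISIBILITY LEDGER (the chain).**  Backgrounds `P 0, P 1, …` on `ZMod M` with `P (i+1) = displace (P i) (κ i) (R i)`: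
slot `i` switched ON displaces the unit field by `y` with law `κ i` (nonnegative, mass `1`, INTEGER mean `c i < R i`); slot `i`
switched OFF = its displacement FROZEN at the mean (`δ_{c i}`: the fluctuation not integrated — a sure shift, invisible up to
relabelling).  Then the visibility of every slot is SECOND order against the INITIAL background's second differences,
`‖P (i+1) − P i (· − c i)‖₁ ≤ C i · ‖D²(P 0)‖₁` with `C i = Σ_y |κ i y − δ_{c i} y|·Σ_{k<y} k` (≤ the displacement range squared), because
smoothness is inherited along the chain (`l1Norm_bdiff2_displace_le`); summed: `Σ_{i<n} vis i ≤ (Σ_{i<n} C i)·‖D²(P 0)‖₁`.  With `Λ^{K−j}`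
slots of age `K − j` and ranges `R ≍ M·θ₁^{K−j}` against `‖D²(P 0)‖₁ ≍ M⁻²` this is the slice profile `(θ₁²Λ)^{K−j}` of
`OldInfluenceBudget` — INHABITED BY COMPUTATION in a model where the observable is arbitrary (file 1: it never enters) and the slots
interact through it; reading, not certified. [folklore] -/
theorem sum_visibility_chain_le (P : ℕ → ZMod M → ℝ) (κ : ℕ → ℕ → ℝ) (R c : ℕ → ℕ)
    (hstep : ∀ i, P (i + 1) = displace (P i) (κ i) (R i)) (hκ : ∀ i y, 0 ≤ κ i y)
    (hmass : ∀ i, ∑ y ∈ range (R i), κ i y = 1) (hc : ∀ i, c i < R i)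
    (hmean : ∀ i, ∑ y ∈ range (R i), (y : ℝ) * κ i y = c i) (n : ℕ) :
    ∑ i ∈ range n, l1Norm (fun u => P (i + 1) u - P i (u - ↑(c i)))
      ≤ (∑ i ∈ range n, ∑ y ∈ range (R i), |κ i y - (if y = c i then 1 else 0)| * ∑ k ∈ range y, (k : ℝ))
        * l1Norm (bdiff (bdiff (P 0))) := by
  -- smoothness inherited: `‖D²(P i)‖₁ ≤ ‖D²(P 0)‖₁`
  have hsmooth : ∀ i, l1Norm (bdiff (bdiff (P i))) ≤ l1Norm (bdiff (bdiff (P 0))) := by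
    intro i
    induction i with
    | zero => exact le_rfl
    | succ i ih => rw [hstep i]; exact (l1Norm_bdiff2_displace_le (P i) (hκ i) (hmass i)).trans ih
  rw [sum_mul]
  refine sum_le_sum fun i _ => ?_
  -- slot `i`: frozen law `δ_{c i}` vs `κ i` — equal masses, equal means
  have hδ : ∑ y ∈ range (R i), (if y = c i then (1 : ℝ) else 0) = 1 := by
    rw [sum_ite_eq' (range (R i)) (c i) (fun _ => (1 : ℝ))]
    simp [mem_range.mpr (hc i)]
  have h0 : ∑ y ∈ range (R i), (κ i y - (if y = c i then 1 else 0)) = 0 := by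
    rw [sum_sub_distrib, hmass i, hδ, sub_self]
  have h1 : ∑ y ∈ range (R i), (y : ℝ) * (κ i y - (if y = c i then 1 else 0)) = 0 := by
    simp only [mul_sub]
    rw [sum_sub_distrib, hmean i, sum_dirac_eq (hc i) (fun y => (y : ℝ)), sub_self]
  have hvis := l1_displace_sub_le_second (P i) (fun y => if y = c i then 1 else 0) (κ i) (R i) h0 h1
  have hoff : displace (P i) (fun y => if y = c i then 1 else 0) (R i) = fun u => P i (u - ↑(c i)) := displace_dirac (P i) (hc i)
  have hC : 0 ≤ ∑ y ∈ range (R i), |κ i y - (if y = c i then 1 else 0)| * ∑ k ∈ range y, (k : ℝ) :=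
    sum_nonneg fun y _ => mul_nonneg (abs_nonneg _) (sum_nonneg fun k _ => Nat.cast_nonneg k)
  calc l1Norm (fun u => P (i + 1) u - P i (u - ↑(c i)))
      = l1Norm (fun u => displace (P i) (κ i) (R i) u - displace (P i) (fun y => if y = c i then 1 else 0) (R i) u) := by
        rw [hoff, hstep i]
    _ ≤ (∑ y ∈ range (R i), |κ i y - (if y = c i then 1 else 0)| * ∑ k ∈ range y, (k : ℝ)) * l1Norm (bdiff (bdiff (P i))) := hvis
    _ ≤ (∑ y ∈ range (R i), |κ i y - (if y = c i then 1 else 0)| * ∑ k ∈ range y, (k : ℝ)) * l1Norm (bdiff (bdiff (P 0))) :=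
        mul_le_mul_of_nonneg_left (hsmooth i) hC

end Periodic

end Summit.QuantumFields.BalabanUV.T4Continuum.NE1p.TiltedMeanVisibilityCentred

end
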